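import Summits.QuantumAdvantage.QuantumAdvantage.Theorems.ColumnBridgeC
import Summits.QuantumAdvantage.QuantumAdvantage.Theorems.DisperseArithmeticA

set_option linter.dupNamespace false
set_option linter.unusedSectionVars false

/-!
# ColumnBridgeD (lens 4, g29; the (c0) dispersing branch — EXPLICIT FORM)

Blocker `X = AbsorptionDial.NoPerfectPolyOdd` (item 28487); decomp-qadv lens 4, g29.  `loss_of_Free_explicit` is `ColumnBridgeC.loss_of_Free`
(kernel Y's `JointFreeness.Free` on `B` + prepared labels + a dispersed cross block ⟹ some input loses) with the numeric side conditions
`hsmall` and `hcountA` DISCHARGED by the explicit polynomial-size parameter bounds of `DisperseArithmeticA` (`hsmall_of`, `hcountA_of`):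
`w ≥ 4p²(3 + (r+k+1)p)`, `w₂ ≥ 4p²(6 + 2(r+k+1)p)`, `324·p^{2(r+k+1)}·E ≤ 4^{|Side₁|}`, `m ≥ (2p−1)t` with `2^t > (n+1)·2p^k`; the cut-size
condition `2^r > 3p^{2k}((n+1)·2p^k + 1)` is kept as is (met by `r := Nat.log 2 _ + 1`).  Every bound is polynomial in `p`, `k ≤ (log n)^C`, `log n`.

Supports stmt-QuantumAdvantage-28487 (record; the residual `X` is NOT claimed).
-/

open Finset
open Summit.QuantumAdvantage.AdviceFreeQNC0
open Summit.QuantumAdvantage.QuantumAdvantage.Theorems.InnerDegreeDial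
open Summit.QuantumAdvantage.QuantumAdvantage.Theorems.BilinearCubeSum
open Summit.QuantumAdvantage.QuantumAdvantage.Theorems.LabelPreparation

namespace Summit.QuantumAdvantage.QuantumAdvantage.Theorems.ColumnBridge

variable {p : ℕ} [Fact p.Prime] {n m : ℕ}

/-- **THE DISPERSING BRANCH, EXPLICIT FORM.**  `loss_of_Free` with the numeric side conditions `hsmall` / `hcountA` discharged by explicit
polynomial-size parameter bounds (`DisperseArithmetic.hsmall_of`, `DisperseArithmetic.hcountA_of`). -/
theorem loss_of_Free_explicit (hp5 : 5 ≤ p) (hp3 : p.Coprime 3) {k r : ℕ} (c : ℕ)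
    (y : Fin (n + 1) → (Fin n → Bool) → Bool) (g₀ : Fin (n + 1))
    (lam : Fin (n + 1) → Fin k → Fin n → ZMod p) (F : Fin (n + 1) → (Fin k → ZMod p) → Bool)
    (hF : ∀ g, g ≠ g₀ → ∀ u, y g u = F g (fun j => ∑ i, if u i = true then lam g j i else 0))
    (Λ : Fin k → Fin n → ZMod p) (M : Fin n → Fin n → ZMod p) (b : Fin n → ZMod p)
    (H : (Fin k → ZMod p) → ZMod p → Bool)
    (hy₀ : ∀ u, y g₀ u = H (fun j => ∑ i, if u i = true then Λ j i else 0) (quadVal M b u))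
    (U₀ : Finset (Fin n)) (w₀ : ℕ) (hprep : Prepared Λ w₀ U₀)
    (e : Fin r ↪ Fin n) (T : Fin m ↪ Fin n) (heT : ∀ j i, e j ≠ T i) (B : Finset (Fin n))
    (hTB : ∀ l, l ∈ B ↔ ∃ i, T i = l) (hBU : ∀ l ∈ B, l ∉ U₀) (side : Fin m → Bool)
    (w : ℕ) (hw : w ≤ m) (hcorr : w + (univ.filter fun i : Fin n => i ∉ U₀ ∧ i ∉ B).card ≤ w₀)
    (hFree : JointFreeness.Free (fun (_ : Fin 1) i l => M i l + M l i) Λ B w (univ.map e))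
    (w₂ E : ℕ)
    (hdisp : (univ.filter fun xx : (Side₁ side → Bool) × (Side₁ side → Bool) =>
      (univ.filter fun j => (rowForm (Cx M T side) xx.1 - rowForm (Cx M T side) xx.2) j ≠ 0).card < w₂).card ≤ E)
    (hwlarge : 4 * p ^ 2 * (3 + (r + k + 1) * p) ≤ w) (hw₂large : 4 * p ^ 2 * (6 + 2 * (r + k + 1) * p) ≤ w₂)
    (hE : 324 * p ^ (2 * (r + k + 1)) * E ≤ 4 ^ Fintype.card (Side₁ side))
    (t : ℕ) (hm : (2 * p - 1) * t ≤ m) (ht : (n + 1) * (p ^ k * 2) < 2 ^ t)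
    (hcountB : 3 * p ^ k * p ^ k * ((n + 1) * (p ^ k * 2) + 1) < 2 ^ r) :
    ∃ u, ringWinU c y u = false :=
  loss_of_Free hp5 hp3 c y g₀ lam F hF Λ M b H hy₀ U₀ w₀ hprep e T heT B hTB hBU side w hw hcorr hFree w₂ E hdisp
    (DisperseArithmetic.hsmall_of hp5 hwlarge hw₂large hE) (DisperseArithmetic.hcountA_of (by omega) hm ht) hcountB

end Summit.QuantumAdvantage.QuantumAdvantage.Theorems.ColumnBridge
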